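import Summits.HodgeConjecture.HodgeConjecture.Theorems.F0LD2ThetaTensorClasses
import Summits.HodgeConjecture.HodgeConjecture.Theorems.F0LD2FrameTransportPin
import Literature.NumberTheory.Weil1964.AdelicMetaplecticFinRepReindex
import HarnessLib

set_option Elab.async false

/-!
# Crux `HLiu418`, line LD1 — (Gβ-L) F2: FINITE-FACTOR EQUIVARIANCE OF THE THETA CLASS IN THE `Fin n′` CURRENCY UNDER THE PINNED TRANSPORT
# (THEOREMS ONLY)

Cell hodgecm-mathlib, FLOOR 0, programme-6 line LD1 (socket `stub_S1_facts`, #73 E1θhol), LD1-p01 (g2), brick F2 of the (Gβ-L) `FiniteLevel` organ of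
LD1-plan's (I′) GERM ROAD junction; `--supports stmt-HodgeConjecture-24832`.  Namespace
`Summit.HodgeConjecture.HodgeConjecture.Cruxes.HLiu418.F0LD1ThetaClassFinEquivariancePin`.  KERNEL ONLY: theorems; no definition, no named fact, no
`sorry`, no instance, no notation.  Nothing of [Liu2021] is asserted; HC_CM is proved only modulo the 7 printed citations (2 remaining: hLiu418 =
stmt-HodgeConjecture-24832, h413 = stmt-HodgeConjecture-24833) until rung 0 closes; count-neutral.

THE POINT.  ★ `F0LD2ThetaTensorClasses.rightRegular_finAdelicToAdelic_toLp_lineThetaLift_tensor` (LD2-p02) is the `U(H)(𝔸_{L⁺,f})`-equivariance of the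
pure-tensor theta classes in the REINDEXED currency `R_e E_{N×1}(φ ⊗ Φ_f)` with an abstract finite-part hypothesis `hιAf`.  The junction's class
currency is `E_{n′}(φ ⊗ Φ_f)` (LD1-plan 09:00:11Z) under the PIN `ιA k = g_𝔸⁻¹ k g_𝔸` (the binder of ★ `F0LD1ThetaGermDefs.ThetaSlice₂`).  This file
restates the equivariance there: with `Φ_f = R_e^f Ψ` (★ `finSBReindex`, a linear equivalence) and the letters' finite transport
`ι_V = (finAdelicCongr … g ht hg)⁻¹ : U(H)(𝔸_f) ≃ₜ* U(diag dV)(𝔸_f)` (★ `F0LD2FrameTransportPin.pin_finAdelicToAdelic`: `ιA(1,k) = (1, ι_V k)`),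

* `rightRegular_finAdelicToAdelic_toLp_lineThetaLift_tmul_finSBReindex` — `R((1,k)) [Θ̃_{E(φ ⊗ R_e^f Ψ)}(f) ∘ ιA] = [Θ̃_{E(φ ⊗ R_e^f ω_f(ι_V k, 1)Ψ)}(f) ∘ ιA]`
  (bridge ★ `piSBReindex_tmul` ∕ ★ `schwartzReindexCLM_schwartzReindexCLM_symm`, as in ★ `F0LD1ThetaClassFinSliceFinite`);
* `rightRegular_finAdelicToAdelic_toLp_lineThetaLift_tmul_finSBReindex_of_fixed` — if `ω_f(ι_V k, 1) Ψ = Ψ` the class is FIXED by `R((1,k))`.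

HONEST SCOPE.  Currency bookkeeping over ★ bricks; nothing of [Liu2021] is asserted; no book row moves by this file alone.

## References
* [BorelJacquet1979] A. Borel, H. Jacquet, PSPM 33.1 (1979), §4.1, §4.6.
* [Weil1964] A. Weil, Acta Math. 111 (1964), Chap. III n° 37–38 pp. 188–190.
* [PlatonovRapinchuk1994] V. Platonov, A. Rapinchuk (1994), §2.3.
-/

set_option autoImplicit false
-- the mandated namespace has the single-problem summit's repeated segment (`HodgeConjecture.HodgeConjecture`)
set_option linter.dupNamespace false

noncomputable section

open NumberField MeasureTheory IsDedekindDomain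
open scoped Matrix Kronecker ComplexOrder ENNReal SchwartzMap TensorProduct Classical


open _root_.MeasureTheory
open Literature.NumberTheory.Automorphic Literature.NumberTheory.Automorphic.UnitaryGroup
open Literature.NumberTheory.Automorphic.UnitaryGroup.CotangentForms
open Literature.NumberTheory.Automorphic.IdeleClassGroup
open Literature.NumberTheory.Automorphic.Liu2021
open Literature.NumberTheory.Automorphic.Liu2021.Def411WeilCarriers
open Literature.NumberTheory.Automorphic.Liu2021.Def411WeilCarriersDoubling
open Literature.NumberTheory.GelbartRogawski1991 Literature.NumberTheory.GelbartRogawski1991.UnitaryDualPair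
open Literature.NumberTheory.GelbartRogawski1991.UnitaryDualPair.WeilCoinv
open Literature.NumberTheory.Weil1964
open Literature.RepresentationTheory Literature.RepresentationTheory.Liu2021
open Literature.RepresentationTheory.CompactGroups
open Literature.RepresentationTheory.HeisenbergGroup
open Summit.HodgeConjecture.HodgeConjecture.Cruxes.HLiu418.F0LD1ThetaTransportKit

namespace Summit.HodgeConjecture.HodgeConjecture.Cruxes.HLiu418.F0LD1ThetaClassFinEquivariancePin

open Summit.HodgeConjecture.HodgeConjecture.Cruxes.HLiu418.F0LD1ThetaTransportKit
open Summit.HodgeConjecture.HodgeConjecture.Cruxes.HLiu418.F0LD2ThetaTensorClasses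
open Summit.HodgeConjecture.HodgeConjecture.Cruxes.HLiu418.F0LD2FrameTransportPin

section Pin

variable (L : Type) [Field L] [NumberField L] [IsCMField L] (N : ℕ) (H : Matrix (Fin N) (Fin N) L)
  {n' : ℕ} (e₁ : Fin N × Fin 1 ≃ Fin n') (dV : Fin N → L) (hdV : ∀ i, IsCMField.complexConj L (dV i) = dV i)
  (hdV0 : ∀ i, dV i ≠ 0)
  (ιA : (adelicGroupData (↥(maximalRealSubfield L)) L (IsCMField.complexConj L) N H).Adelic →* ↥(UnitaryGroup.adelic (↥(maximalRealSubfield L)) L (IsCMField.complexConj L) N (Matrix.diagonal dV)))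
  (hιA : Continuous ιA ∧ ∀ ⦃γ : (adelicGroupData (↥(maximalRealSubfield L)) L (IsCMField.complexConj L) N H).Adelic⦄,
    γ ∈ (UnitaryGroup.toAdelic (↥(maximalRealSubfield L)) L (IsCMField.complexConj L) N H).range →
      ιA γ ∈ (UnitaryGroup.toAdelic (↥(maximalRealSubfield L)) L (IsCMField.complexConj L) N (Matrix.diagonal dV)).range)
  (μ : Literature.NumberTheory.Automorphic.IdeleClassGroup L →ₜ* Circle) (hμ : IsConjugateSymplectic L μ) (a : (↥(maximalRealSubfield L))ˣ)
  (hρ : HasThetaMajorants fun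
      (p : ↥(UnitaryGroup.adelic (↥(maximalRealSubfield L)) L (IsCMField.complexConj L) N (Matrix.diagonal dV)) × ↥(UnitaryGroup.adelic (↥(maximalRealSubfield L)) L (IsCMField.complexConj L) 1 (JW (↥(maximalRealSubfield L)) L a))) (Φ : piSchwartzBruhat (↥(maximalRealSubfield L)) (Fin n')) =>
        pairRep (↥(maximalRealSubfield L)) L (IsCMField.complexConj L) N 1 e₁ (Matrix.diagonal dV) (JW (↥(maximalRealSubfield L)) L a)
          (chiSplittingLine L e₁ dV hdV hdV0 (toHeckeCharacter L μ) (isUnitary_toHeckeCharacter L μ)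
            ((isOscillatorChar_toHeckeCharacter_iff μ).mpr hμ) (TW (↥(maximalRealSubfield L)) a)
            (isUnit_det_TW (↥(maximalRealSubfield L)) a) (JW (↥(maximalRealSubfield L)) L a) (JW_eq (↥(maximalRealSubfield L)) L a))
          p Φ)
  [CompactSpace (↥(UnitaryGroup.adelic (↥(maximalRealSubfield L)) L (IsCMField.complexConj L) N (Matrix.diagonal dV)) ⧸ (UnitaryGroup.toAdelic (↥(maximalRealSubfield L)) L (IsCMField.complexConj L) N (Matrix.diagonal dV)).range)] [MeasurableSpace (↥(UnitaryGroup.adelic (↥(maximalRealSubfield L)) L (IsCMField.complexConj L) 1 (JW (↥(maximalRealSubfield L)) L a)) ⧸ (UnitaryGroup.toAdelic (↥(maximalRealSubfield L)) L (IsCMField.complexConj L) 1 (JW (↥(maximalRealSubfield L)) L a)).range)] (μW : Measure (↥(UnitaryGroup.adelic (↥(maximalRealSubfield L)) L (IsCMField.complexConj L) 1 (JW (↥(maximalRealSubfield L)) L a)) ⧸ (UnitaryGroup.toAdelic (↥(maximalRealSubfield L)) L (IsCMField.complexConj L) 1 (JW (↥(maximalRealSubfield L)) L a)).range))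
  (f : C((↥(UnitaryGroup.adelic (↥(maximalRealSubfield L)) L (IsCMField.complexConj L) 1 (JW (↥(maximalRealSubfield L)) L a)) ⧸ (UnitaryGroup.toAdelic (↥(maximalRealSubfield L)) L (IsCMField.complexConj L) 1 (JW (↥(maximalRealSubfield L)) L a)).range), ℂ))
  (φ : 𝓢((Fin n' → NumberField.mixedEmbedding.mixedSpace ↥(maximalRealSubfield L)), ℂ))
  [CompactSpace (adelicGroupData (↥(maximalRealSubfield L)) L (IsCMField.complexConj L) N H).automorphicQuotient]
  (ν : Measure (adelicGroupData (↥(maximalRealSubfield L)) L (IsCMField.complexConj L) N H).automorphicQuotient) [IsFiniteMeasure ν]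
variable [BorelSpace (↥(UnitaryGroup.adelic (↥(maximalRealSubfield L)) L (IsCMField.complexConj L) 1 (JW (↥(maximalRealSubfield L)) L a)) ⧸ (UnitaryGroup.toAdelic (↥(maximalRealSubfield L)) L (IsCMField.complexConj L) 1 (JW (↥(maximalRealSubfield L)) L a)).range)] [IsFiniteMeasure μW]
variable [SMulInvariantMeasure (adelicGroupData (↥(maximalRealSubfield L)) L (IsCMField.complexConj L) N H).Adelic (adelicGroupData (↥(maximalRealSubfield L)) L (IsCMField.complexConj L) N H).automorphicQuotient ν]
  (t : L) (ht : t ≠ 0) (g : GL (Fin N) L)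
  (hg : formCongr ((IsCMField.complexConj L : L ≃ₐ[↥(maximalRealSubfield L)] L) : L →+* L) g (t • H) = Matrix.diagonal dV)
  (hpin : ∀ k, ((ιA k : ↥(UnitaryGroup.adelic (↥(maximalRealSubfield L)) L (IsCMField.complexConj L) N (Matrix.diagonal dV))) :
      GL (Fin N) (AdeleRing (𝓞 L) L)) =
    (toAdeleGL L g)⁻¹ * adelicVal (↥(maximalRealSubfield L)) L (IsCMField.complexConj L) N H k * toAdeleGL L g)

include hιA hpin ht in
/-- **Finite-factor equivariance in the `Fin n′` currency under the pin**:
`R((1,k)) [Θ̃_{E(φ ⊗ R_e^f Ψ)}(f) ∘ ιA] = [Θ̃_{E(φ ⊗ R_e^f ω_f(ι_V k, 1)Ψ)}(f) ∘ ιA]`, `ι_V = (finAdelicCongr … g ht hg)⁻¹`.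
[cite: BorelJacquet1979, §4.6] [cite: Weil1964, Chap. III n° 37–38 pp. 188–190] -/
theorem rightRegular_finAdelicToAdelic_toLp_lineThetaLift_tmul_finSBReindex
    (k : finAdelic (↥(maximalRealSubfield L)) L (IsCMField.complexConj L) N H) (Ψ : FinSB (↥(maximalRealSubfield L)) (Fin N × Fin 1)) :
    (adelicGroupData (↥(maximalRealSubfield L)) L (IsCMField.complexConj L) N H).rightRegular ν (finAdelicToAdelic (↥(maximalRealSubfield L)) L (IsCMField.complexConj L) N H k)
        (MemLp.toLp _ (memLp_toQuotFun_lineThetaLift L N H e₁ dV hdV hdV0 ιA hιA μ hμ a hρ μW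
          (piSchwartzBruhatEquiv (↥(maximalRealSubfield L)) (Fin n') (φ ⊗ₜ[ℂ] finSBReindex (↥(maximalRealSubfield L)) e₁ Ψ)) f ν 2)) =
      MemLp.toLp _ (memLp_toQuotFun_lineThetaLift L N H e₁ dV hdV hdV0 ιA hιA μ hμ a hρ μW
          (piSchwartzBruhatEquiv (↥(maximalRealSubfield L)) (Fin n') (φ ⊗ₜ[ℂ] finSBReindex (↥(maximalRealSubfield L)) e₁ (finPairRep (↥(maximalRealSubfield L)) L (IsCMField.complexConj L) N 1 e₁ (Matrix.diagonal dV) (JW (↥(maximalRealSubfield L)) L a)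
            (complexConj_imagUnit L) (imagUnit_ne_zero L) (imagUnit_mul_self L) (realDiagonal_isSymm L dV hdV) (isSymm_TW (↥(maximalRealSubfield L)) a)
            (isUnit_det_realDiagonal L dV hdV hdV0) (isUnit_det_TW (↥(maximalRealSubfield L)) a) (realDiagonal_map L dV hdV).symm
            (JW_eq (↥(maximalRealSubfield L)) L a)
            (isCompatible_chiSplittingLine L e₁ dV hdV hdV0 (toHeckeCharacter L μ) (isUnitary_toHeckeCharacter L μ)
              ((isOscillatorChar_toHeckeCharacter_iff μ).mpr hμ) (TW (↥(maximalRealSubfield L)) a) (isSymm_TW (↥(maximalRealSubfield L)) a)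
              (isUnit_det_TW (↥(maximalRealSubfield L)) a) (JW (↥(maximalRealSubfield L)) L a) (JW_eq (↥(maximalRealSubfield L)) L a)) ((finAdelicCongr (↥(maximalRealSubfield L)) L (IsCMField.complexConj L) g ht hg).symm k, 1) Ψ))) f ν 2) := by
  -- bridge to the reindexed currency `R_e E_{N×1}(φ′ ⊗ ·)`, `φ′ = R_{e⁻¹}^∞ φ`
  have hre : ∀ Φf : FinSB (↥(maximalRealSubfield L)) (Fin N × Fin 1),
      piSchwartzBruhatEquiv (↥(maximalRealSubfield L)) (Fin n') (φ ⊗ₜ[ℂ] finSBReindex (↥(maximalRealSubfield L)) e₁ Φf) =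
        piSBReindex (↥(maximalRealSubfield L)) e₁ (piSchwartzBruhatEquiv (↥(maximalRealSubfield L)) (Fin N × Fin 1)
          (schwartzReindexCLM (↥(maximalRealSubfield L)) e₁.symm φ ⊗ₜ[ℂ] Φf)) := fun Φf => by
    rw [piSBReindex_tmul, schwartzReindexCLM_schwartzReindexCLM_symm]
  -- the pin gives LD2's finite-part hypothesis and identifies the finite part with `ι_V k`
  have hfin : ∀ k' : finAdelic (↥(maximalRealSubfield L)) L (IsCMField.complexConj L) N H,
      finPart (↥(maximalRealSubfield L)) L (IsCMField.complexConj L) N (Matrix.diagonal dV) (ιA (finAdelicToAdelic (↥(maximalRealSubfield L)) L (IsCMField.complexConj L) N H k')) = (finAdelicCongr (↥(maximalRealSubfield L)) L (IsCMField.complexConj L) g ht hg).symm k' :=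
    fun k' => finPart_pin_eq_finAdelicCongr_symm L N H dV t ht g hg ιA hpin k'
  have hιAf : ∀ k' : finAdelic (↥(maximalRealSubfield L)) L (IsCMField.complexConj L) N H, ιA (finAdelicToAdelic (↥(maximalRealSubfield L)) L (IsCMField.complexConj L) N H k') =
      finAdelicToAdelic (↥(maximalRealSubfield L)) L (IsCMField.complexConj L) N (Matrix.diagonal dV)
        (finPart (↥(maximalRealSubfield L)) L (IsCMField.complexConj L) N (Matrix.diagonal dV) (ιA (finAdelicToAdelic (↥(maximalRealSubfield L)) L (IsCMField.complexConj L) N H k'))) := fun k' => by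
    rw [hfin, pin_finAdelicToAdelic L N H dV t ht g hg ιA hpin k']
  rw [toLp_lineThetaLift_congr L N H e₁ dV hdV hdV0 ιA hιA μ hμ a hρ μW f ν (hre Ψ),
    toLp_lineThetaLift_congr L N H e₁ dV hdV hdV0 ιA hιA μ hμ a hρ μW f ν (hre _),
    F0LD2ThetaTensorClasses.rightRegular_finAdelicToAdelic_toLp_lineThetaLift_tensor L N H e₁ dV hdV hdV0 ιA hιA μ hμ a hρ μW f _ ν hιAf k Ψ,
    hfin k]

include hιA hpin ht in
/-- **A class of fixed finite datum is fixed**: if `ω_f(ι_V k, 1) Ψ = Ψ` then `R((1,k))` fixes `[Θ̃_{E(φ ⊗ R_e^f Ψ)}(f) ∘ ιA]`.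
[cite: BorelJacquet1979, §4.6] -/
theorem rightRegular_finAdelicToAdelic_toLp_lineThetaLift_tmul_finSBReindex_of_fixed
    (k : finAdelic (↥(maximalRealSubfield L)) L (IsCMField.complexConj L) N H) (Ψ : FinSB (↥(maximalRealSubfield L)) (Fin N × Fin 1))
    (hfix : finPairRep (↥(maximalRealSubfield L)) L (IsCMField.complexConj L) N 1 e₁ (Matrix.diagonal dV) (JW (↥(maximalRealSubfield L)) L a)
            (complexConj_imagUnit L) (imagUnit_ne_zero L) (imagUnit_mul_self L) (realDiagonal_isSymm L dV hdV) (isSymm_TW (↥(maximalRealSubfield L)) a)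
            (isUnit_det_realDiagonal L dV hdV hdV0) (isUnit_det_TW (↥(maximalRealSubfield L)) a) (realDiagonal_map L dV hdV).symm
            (JW_eq (↥(maximalRealSubfield L)) L a)
            (isCompatible_chiSplittingLine L e₁ dV hdV hdV0 (toHeckeCharacter L μ) (isUnitary_toHeckeCharacter L μ)
              ((isOscillatorChar_toHeckeCharacter_iff μ).mpr hμ) (TW (↥(maximalRealSubfield L)) a) (isSymm_TW (↥(maximalRealSubfield L)) a)
              (isUnit_det_TW (↥(maximalRealSubfield L)) a) (JW (↥(maximalRealSubfield L)) L a) (JW_eq (↥(maximalRealSubfield L)) L a)) ((finAdelicCongr (↥(maximalRealSubfield L)) L (IsCMField.complexConj L) g ht hg).symm k, 1) Ψ = Ψ) :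
    (adelicGroupData (↥(maximalRealSubfield L)) L (IsCMField.complexConj L) N H).rightRegular ν (finAdelicToAdelic (↥(maximalRealSubfield L)) L (IsCMField.complexConj L) N H k)
        (MemLp.toLp _ (memLp_toQuotFun_lineThetaLift L N H e₁ dV hdV hdV0 ιA hιA μ hμ a hρ μW
          (piSchwartzBruhatEquiv (↥(maximalRealSubfield L)) (Fin n') (φ ⊗ₜ[ℂ] finSBReindex (↥(maximalRealSubfield L)) e₁ Ψ)) f ν 2)) =
      MemLp.toLp _ (memLp_toQuotFun_lineThetaLift L N H e₁ dV hdV hdV0 ιA hιA μ hμ a hρ μW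
          (piSchwartzBruhatEquiv (↥(maximalRealSubfield L)) (Fin n') (φ ⊗ₜ[ℂ] finSBReindex (↥(maximalRealSubfield L)) e₁ Ψ)) f ν 2) := by
  rw [rightRegular_finAdelicToAdelic_toLp_lineThetaLift_tmul_finSBReindex L N H e₁ dV hdV hdV0 ιA hιA μ hμ a hρ μW f φ ν t ht g hg hpin k Ψ,
    hfix]

end Pin

end Summit.HodgeConjecture.HodgeConjecture.Cruxes.HLiu418.F0LD1ThetaClassFinEquivariancePin

end
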